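import Summits.QuantumFields.YangMills.Theorems.BalabanUVNodesN11NoExpansionGeneralStepLawsCoPH
import Summits.QuantumFields.YangMills.Theorems.BalabanUVNodesN11NoExpansionGeneralStepCoPHOldBranch
import Literature.MathematicalPhysics.QuantumFieldTheory.Balaban1983to89.B16RLeafRecord13LiveCoPH

/-!
# DAG node N11 — THEOREM 1's INDUCTIVE STEP AT THE v1.7 `CoPH` RECORD REDUCED TO THE EXPANSION SEQUENCES: `TLaw₁₃CoPH θ p k` (hence `SLaw₁₃CoPH θ p (k+1)` on the live-selector
# line) FROM the §2 form of `ρ_k` with its witness exposed, a candidate 𝐓-image witness family that KEEPS THE OLD TERMS and carries universal new `𝐄^{(k+1)}`-terms obeying r11's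
# new-term clauses, dag-n11-d's no-expansion data — AND, displayed, [III] §3's deliverable AT THE SEQUENCES WITH `Ω_{k+1}(s′) ≠ ∅` ONLY

Cell `pub-ymgap`, YM-PLAN Track A (HUMAN RULING D-0062), seat `pub-ymgap-dag-n11-e` (g12; R134 fan-out row N11∕s3 «`ThmP245Printed` via `rOperation` from N13's `ROpLeaf`»),
route `BalabanUVNodes` rev 25 (v1.7 `CoPH` key), item K1⁷ `StabilityBAtRecordR13SepCoPH` = stmt-QuantumFields-20542 (helper lane, count-neutral).  [III] = [Balaban1988Convergent],
[IV] = [Balaban1989LargeFieldI].  Sequel of this seat's `…NoExpansionTruncatedWitness` (p549689), `…NoExpansionGeneralStepLawsCoPH` (p550088) and `…B16RLeafRecord13LiveCoPH` (p540794)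
over dag-n11-d's `…NoExpansionGeneralStepCoPHOldBranch`.

WHY THIS FILE.  N11's residue at the record is (S1ᵀ) «`SLaw₁₃CoPH θ p k → TLaw₁₃CoPH θ p k`» ([III] Theorem p. 245); `TLaw₁₃CoPH θ p k` is, by node00-def-T's `tLaw₁₃CoPH_iff`, a
witness family `(t′, E′)` over the new sequences `s′` of length `k+1`, UNIVERSAL in its 𝐄-component, with, at EVERY `s′`, the 𝐓-image law package `Sect2.LawsT … k` AND the
𝐓-image clause.  The new sequences split by `Ω_{k+1}(s′)`.  This file PROVES the `Ω_{k+1}(s′) = ∅` half for the natural candidate family — old terms of `SLaw_k`'s witness at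
`init s′` kept, no new `𝐑 ∕ 𝐁`, the universal new `𝐄^{(k+1)}` (whatever [III] §3 constructs in the expansion regions) riding along unsummed — from three kernel facts: §0 such a
witness obeys `LawsT … k` from `LawsRT … k` and r11's new-term 𝐄-clauses (`lawsT_towerOfTerms_of_lawsRT_of_agree_of_newE`); the history's tower at `s′` IS the one at `init s′`
(p550088); the slot at `s′` does not read the witness above level `k` (p549689) — so dag-n11-d's clause for `t (init s′)` (old-branch form) is the clause for `t′ s′`.  The
`Ω_{k+1}(s′) ≠ ∅` half is DISPLAYED as the hypothesis `hexp` — [III] Sect. 1 ∕ §3 ∕ Thm 2 proper, the load-bearing content of (S1ᵀ), NOT proved here.  HENCE: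
§1 ★★★ `tLaw₁₃CoPH_of_formAtZS_of_newTerms_of_expansion` — `TLaw₁₃CoPH θ p k` from: the v1.7 core provisos, `k < K`, `1 ≤ M`, `0 ≤ B₀`; the §2 form of `ρ_k` WITH ITS WITNESS `(t, E_k)`
   (node00-def-T's `HasSect2FormAtZS` at the laws `LawsRT … k` — `SLaw₁₃CoPH θ p k` unfolds to `∃ t E_k` of exactly this); a candidate family `(tT, EkT)` universal in 𝐄 which at every
   no-expansion `s′` keeps the old terms (`hold`), has no `𝐑^{(k+1)} ∕ 𝐁^{(k+1)}` (`hnoR ∕ hnoB`), carries `E_k(init s′)` (`hEk`) and whose `𝐄^{(k+1)}` obeys r11's new-term clauses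
   (`hlocE ∕ hinvE ∕ hbdE ∕ hanE`); dag-n11-d's displayed no-expansion data for `t (init s′)` ((P) `hpre`, (V) `hZ` + `hq`, `hqloc`, `hA`, old-branch `hmB ∕ hCB`); and `hexp`.
§2 ★★★ `sLaw₁₃CoPH_succ_of_formAtZS_of_newTerms_of_expansion_of_liveSel` — … hence `SLaw₁₃CoPH θ p (k+1)` on the live-selector line (this seat's
   `…LiveCoPH.sLaw₁₃CoPH_succ_of_tLaw₁₃CoPH_of_liveSel_of_rstep`: admissibility, `0 ≤ κ, E₀, B₀`, the selector clause): THEOREM 1's COMPLETE INDUCTIVE STEP `ρ_k ↦ ρ_{k+1}` AT THE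
   RECORD, MODULO EXACTLY the expansion-sequence deliverable `hexp`, the new universal 𝐄-terms' clauses, and dag-n11-d's displayed no-expansion binders.

HONEST FRAMING.  Count-neutral kernel bookkeeping; a REDUCTION, not a discharge: `hexp` (every `s′` with `Ω_{k+1}(s′) ≠ ∅`: laws AND clause of the 𝐓-image for the candidate
family) is [III] §3 ∕ Thm 2 proper and is NOT exhibited; the new-term clauses `hlocE ∕ hinvE ∕ hbdE ∕ hanE` are what [III] §3 proves of `𝐄^{(k+1)}` (not exhibited; vacuously met by
`𝐄^{(k+1)} := 0`, which `hexp` then has to tolerate); dag-n11-d's binders stay DISPLAYED (their A6 inhabitant: the history-blind door on the diagonal; `hA` for a general witness is a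
𝐁-locality law, cf. p544575's `…_of_BLocal_…`); the zero branches are not excluded; nothing of Bałaban asserted; N11 NOT discharged; K1⁷ NOT closed; counts unmoved (typed 28∕28 ·
discharged 5∕27).  One finite `𝕋⁴_{L^K}` programme at fixed `ε = L^{−K}`; NOT ℝ⁴ ∕ OS ∕ mass-gap ∕ Clay.
Sources: [III] Theorem p.245, Thm 1 p.262, §2 p.262, (2.17)–(2.18) p.257, (2.20)–(2.31) pp.258–260, (2.40)–(2.42) p.261, (3.1) p.264, (3.24)–(3.25) p.270, p.279; [IV] (0.2)–(0.4)
p.176, p.177 (i)–(ii); [Balaban1987RG1] (0.20) p.256.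
-/

noncomputable section

open MeasureTheory
open scoped BigOperators Matrix.Norms.L2Operator

namespace Summit.QuantumFields.YangMills.Theorems.BalabanUVNodesN11NoExpansionStepReductionCoPH

open Literature.MathematicalPhysics.QuantumFieldTheory.Balaban1983to89 T4Continuum Node00 Node00.Tk DagBinding
open Literature.MathematicalPhysics.QuantumFieldTheory.Balaban1983to89.B16RLeafRecord13LiveCoPH (sLaw₁₃CoPH_succ_of_tLaw₁₃CoPH_of_liveSel_of_rstep)
open BalabanUVNodesN11NoExpansionTruncatedWitness (sect2Slot_succ_congr_of_agree_of_Omega_empty)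
open BalabanUVNodesN11NoExpansionGeneralStepLawsCoPH (sect2TowerOfRecord_rzAt_succ_eq_init_of_Omega_empty)
open BalabanUVNodesN11NoExpansionGeneralStepCoPHOldBranch (clause_succ_CoPH_of_Omega_empty_of_pinChi_of_oldBranch_of_clause)

/-! ## §0. Generic §2 frame — the law package of a witness with old terms kept, no new 𝐑 ∕ 𝐁, and new universal 𝐄-terms obeying r11's new-term clauses -/

section NewE

variable {P : Params} {𝔸 : Type*} [NormedRing 𝔸] [NormedAlgebra ℂ 𝔸] [CompleteSpace 𝔸] {V : Type*} {M : ℕ} {G : Type*} [GaugeGroup G]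

/-- **THE LAW PACKAGE OF A WITNESS WITH OLD TERMS KEPT AND NEW UNIVERSAL 𝐄-TERMS** (generic §2 frame; the companion of `…TruncatedWitness.lawsT_towerOfTerms_of_lawsRT_of_agree_of_vanish`
with the level-`(k+1)` 𝐄-component NOT truncated): term values `t′` that AGREE with `t` at the levels `≤ k`, carry NO `𝐑^{(k+1)}`, `𝐁^{(k+1)}`, and whose `𝐄^{(k+1)}` obeys r11's
new-term clauses at the index `k+1` — local dependence (i), gauge invariance (iii), the IMPROVED bound (decay `(1+4β)κ`, p. 262) and analyticity on `U^c_{k+1}(X, α_{0,k+1}, α_{1,k+1})`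
— obey `Sect2.LawsT … k` on the frame as soon as `t` obeys `Sect2.LawsRT … k` there, given the RG equation at `k`, `0 ≤ B₀` and `0 ≤ g_{k+1}` (print: along a no-expansion step the
only new terms are the universal `𝐄^{(k+1)}(X, ·, z)`, created in the expansion regions of OTHER sequences; `𝐑^{(k+1)}`, `𝐁^{(k+1)}` live on `Λ_{k+1}`, `Ω_{k+1}`-ranges, empty here).
[cite: Balaban1988Convergent, §2 p.262, (2.25)–(2.31) pp.259–260, (2.40)–(2.42) p.261, (3.25) p.270; Balaban1987RG1, (0.20) p.256] -/
theorem lawsT_towerOfTerms_of_lawsRT_of_agree_of_newE (S : Sect2.Setting 𝔸 G) (Rz : Sect2.Residual P 𝔸) (Ω : ℕ → Set (Site P 0))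
    {k : ℕ} {t t' : Sect2.TermValues P 𝔸 V M}
    (hE : ∀ j, j ≤ k → ∀ X z g φ, t'.E j X z g φ = t.E j X z g φ) (hR : ∀ j, j ≤ k → ∀ X φ, t'.R j X φ = t.R j X φ)
    (hB : ∀ j, j ≤ k → ∀ X φ a, t'.B j X φ a = t.B j X φ a)
    (hR' : ∀ X φ, t'.R (k + 1) X φ = 0) (hB' : ∀ X φ a, t'.B (k + 1) X φ a = 0)
    (hlocE : ∀ X z g φ ψ, (Sect2.towerOfTerms S Rz M Ω t').agreeOn (k + 1) X φ ψ → t'.E (k + 1) X z g φ = t'.E (k + 1) X z g ψ)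
    (hinvE : ∀ X z g u φ, t'.E (k + 1) X z g ((Sect2.towerOfTerms S Rz M Ω t').act u φ) = t'.E (k + 1) X z g φ)
    (hbdE : ∀ X z g φ, 0 ≤ g → g ≤ S.lf.γ →
      φ ∈ (Sect2.towerOfTerms S Rz M Ω t').space (k + 1) X (S.lf.alpha0 (S.flow.g (k + 1))) (S.lf.alpha1 (S.flow.g (k + 1))) →
        ‖t'.E (k + 1) X z g φ‖ ≤ S.lf.E₀ * Real.exp (-((1 + 4 * S.βc) * S.lf.κ) * (Sect2.domSys P M (k + 1)).dj X))
    (hanE : ∀ X z g, 0 ≤ g → g ≤ S.lf.γ →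
      AnalyticOnNhd ℂ (t'.E (k + 1) X z g) ((Sect2.towerOfTerms S Rz M Ω t').space (k + 1) X (S.lf.alpha0 (S.flow.g (k + 1))) (S.lf.alpha1 (S.flow.g (k + 1)))))
    (h : Sect2.LawsRT (Sect2.towerOfTerms S Rz M Ω t) S.lf k)
    (hrg : 1 / (S.flow.g k) ^ 2 = 1 / (S.flow.g (k + 1)) ^ 2 + S.flow.β (k + 1) (S.flow.g k))
    (hB₀ : 0 ≤ S.lf.B₀) (hg : 0 ≤ S.flow.g (k + 1)) :
    Sect2.LawsT (Sect2.towerOfTerms S Rz M Ω t') S.lf S.βc k := by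
  obtain ⟨hH, hA⟩ := h
  refine ⟨⟨hH.rg, fun j h1 hj X z g φ ψ hφψ => ?_, fun j h1 hj X φ ψ hφψ => ?_, fun j h1 hj X z g φ hg0 hgγ hφ => ?_,
    fun j h1 hj X φ hφ => ?_, fun j h1 hj X φ a hφ => ?_, fun j h1 hj X z g u φ => ?_, fun j h1 hj X u φ => ?_⟩,
    ⟨hrg, hlocE, fun X φ ψ _ => ?_, hinvE, fun X u φ => ?_, ⟨fun _ X z g φ hg0 hgγ hφ => hbdE X z g φ hg0 hgγ hφ, fun _ X φ _ => ?_, fun _ X φ a _ => ?_⟩⟩,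
    ⟨fun j h1 hj X z g hg0 hgγ => ?_, fun j h1 hj X => ?_, fun j h1 hj X a => ?_⟩⟩
  · show t'.E j X z g φ = t'.E j X z g ψ
    rw [hE j hj, hE j hj]; exact hH.localDepE j h1 hj X z g φ ψ hφψ
  · show t'.R j X φ = t'.R j X ψ
    rw [hR j hj, hR j hj]; exact hH.localDepR j h1 hj X φ ψ hφψ
  · show ‖t'.E j X z g φ‖ ≤ _
    rw [hE j hj]; exact hH.boundE j h1 hj X z g φ hg0 hgγ hφ
  · show ‖t'.R j X φ‖ ≤ _
    rw [hR j hj]; exact hH.boundR j h1 hj X φ hφ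
  · show ‖t'.B j X φ a‖ ≤ _
    rw [hB j hj]; exact hH.boundB j h1 hj X φ a hφ
  · show t'.E j X z g _ = t'.E j X z g φ
    rw [hE j hj, hE j hj]; exact hH.gaugeInvE j h1 hj X z g u φ
  · show t'.R j X _ = t'.R j X φ
    rw [hR j hj, hR j hj]; exact hH.gaugeInvR j h1 hj X u φ
  · show t'.R (k + 1) X φ = t'.R (k + 1) X ψ
    rw [hR', hR']
  · show t'.R (k + 1) X _ = t'.R (k + 1) X φ
    rw [hR', hR']
  · show ‖t'.R (k + 1) X φ‖ ≤ _
    rw [hR', norm_zero]; exact mul_nonneg (pow_nonneg hg _) (Real.exp_nonneg _)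
  · show ‖t'.B (k + 1) X φ a‖ ≤ _
    rw [hB', norm_zero]; exact mul_nonneg hB₀ (Real.exp_nonneg _)
  · rcases Nat.of_le_succ hj with hj' | rfl
    · have hfun : (Sect2.towerOfTerms S Rz M Ω t').E j X z g = (Sect2.towerOfTerms S Rz M Ω t).E j X z g :=
        funext fun φ => hE j hj' X z g φ
      rw [hfun]; exact hA.analyticE j h1 hj' X z g hg0 hgγ
    · exact hanE X z g hg0 hgγ
  · rcases Nat.of_le_succ hj with hj' | rfl
    · have hfun : (Sect2.towerOfTerms S Rz M Ω t').R j X = (Sect2.towerOfTerms S Rz M Ω t).R j X := funext fun φ => hR j hj' X φ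
      rw [hfun]; exact hA.analyticR j h1 hj' X
    · have hfun : (Sect2.towerOfTerms S Rz M Ω t').R (k + 1) X = fun _ => 0 := funext fun φ => hR' X φ
      rw [hfun]; exact analyticOnNhd_const
  · rcases Nat.of_le_succ hj with hj' | rfl
    · have hfun : (fun φ => (Sect2.towerOfTerms S Rz M Ω t').B j X φ a) = fun φ => (Sect2.towerOfTerms S Rz M Ω t).B j X φ a :=
        funext fun φ => hB j hj' X φ a
      rw [hfun]; exact hA.analyticB j h1 hj' X a
    · have hfun : (fun φ => (Sect2.towerOfTerms S Rz M Ω t').B (k + 1) X φ a) = fun _ => (0 : ℂ) := funext fun φ => hB' X φ a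
      rw [hfun]; exact analyticOnNhd_const


end NewE

/-! ## §1. `TLaw₁₃CoPH θ p k` REDUCED TO THE EXPANSION SEQUENCES; §2. hence `SLaw₁₃CoPH θ p (k+1)` on the live-selector line -/

section Reduction

variable {F : T4Family} {N : ℕ} [NeZero N]
variable (θ : Stage13HParams F N) (p : B12.RunParams)

/-- **★★★ `TLaw₁₃CoPH θ p k` — THE 𝐓-IMAGE FORM OF `𝐓ρ_k` AT EVERY NEW SEQUENCE — REDUCED TO THE EXPANSION SEQUENCES.**  See the module header: the candidate family `(tT, EkT)`
(universal in 𝐄, old terms of `(t, E_k)` kept at the no-expansion `s′`, no new `𝐑 ∕ 𝐁` there, new universal `𝐄^{(k+1)}` obeying r11's new-term clauses there, `E_{k+1}(s′) =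
E_k(init s′)` there) IS a witness of `TLaw₁₃CoPH θ p k` as soon as it serves the sequences with `Ω_{k+1}(s′) ≠ ∅` (`hexp`, [III] §3 proper, displayed) — the no-expansion
sequences are served by §0 (laws) and by dag-n11-d's old-branch step for `t (init s′)` read at `tT s′` through p549689's slot invariance (clause).
[cite: Balaban1988Convergent, Theorem p.245, Thm 1 p.262, §2 p.262, (3.24)–(3.25) p.270, (2.18) p.257, (2.20)–(2.31) pp.258–260, (2.40)–(2.42) p.261, p.279; Balaban1989LargeFieldI, (0.2)–(0.3) p.176; Balaban1987RG1, (0.20) p.256] -/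
theorem tLaw₁₃CoPH_of_formAtZS_of_newTerms_of_expansion (h : θ.Provisos₁₃CoPH F N) {k : ℕ} (hk : k < p.K) (hM : 1 ≤ θ.τ9.M) (hB₀ : 0 ≤ θ.s2.lf.B₀)
    (t : SeqOfRecord F θ.ν θ.τ9.M (gOfRecord₁₃ F N θ.toStage13Params p) p.K k → Sect2.TermValues (F.P p.K) (MatA N) (FluctV N) θ.τ9.M)
    (Ek : SeqOfRecord F θ.ν θ.τ9.M (gOfRecord₁₃ F N θ.toStage13Params p) p.K k → ℝ)
    (hS : HasSect2FormAtZS F N (FluctV N) p.K (settingOfRecord₁₃ F N θ.toStage13Params p) k (θ.rzAt p) (WtOfRecord₁₃H F N θ p)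
      (UbgOfRecord₁₃CoP F N θ.toStage13Params p k)
      (fun s u => Sect2.LawsRT (sect2TowerOfRecord F N (FluctV N) p.K (settingOfRecord₁₃ F N θ.toStage13Params p) (θ.rzAt p s) s u)
        (settingOfRecord₁₃ F N θ.toStage13Params p).lf k)
      (slotsOfRecord F N θ.ν θ.τ9 (EOfRecord₁₃ F N θ.toStage13Params) (wOfRecord₉ F N θ.toStage9Params) θ.ppSel p (gOfRecord₁₃ F N θ.toStage13Params p) k) t Ek)
    (tT : SeqOfRecord F θ.ν θ.τ9.M (gOfRecord₁₃ F N θ.toStage13Params p) p.K (k + 1) → Sect2.TermValues (F.P p.K) (MatA N) (FluctV N) θ.τ9.M)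
    (EkT : SeqOfRecord F θ.ν θ.τ9.M (gOfRecord₁₃ F N θ.toStage13Params p) p.K (k + 1) → ℝ) (huT : Sect2.UniversalE tT)
    (hold : ∀ s : SeqOfRecord F θ.ν θ.τ9.M (gOfRecord₁₃ F N θ.toStage13Params p) p.K (k + 1), s.Ω (k + 1) = ∅ →
      (∀ j, j ≤ k → ∀ X z g φ, (tT s).E j X z g φ = (t s.init).E j X z g φ) ∧ (∀ j, j ≤ k → ∀ X φ, (tT s).R j X φ = (t s.init).R j X φ) ∧
        (∀ j, j ≤ k → ∀ X φ a, (tT s).B j X φ a = (t s.init).B j X φ a))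
    (hnoR : ∀ s : SeqOfRecord F θ.ν θ.τ9.M (gOfRecord₁₃ F N θ.toStage13Params p) p.K (k + 1), s.Ω (k + 1) = ∅ → ∀ X φ, (tT s).R (k + 1) X φ = 0)
    (hnoB : ∀ s : SeqOfRecord F θ.ν θ.τ9.M (gOfRecord₁₃ F N θ.toStage13Params p) p.K (k + 1), s.Ω (k + 1) = ∅ → ∀ X φ a, (tT s).B (k + 1) X φ a = 0)
    (hlocE : ∀ s : SeqOfRecord F θ.ν θ.τ9.M (gOfRecord₁₃ F N θ.toStage13Params p) p.K (k + 1), s.Ω (k + 1) = ∅ → ∀ X z g φ ψ,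
      (sect2TowerOfRecord F N (FluctV N) p.K (settingOfRecord₁₃ F N θ.toStage13Params p) (θ.rzAt p s) s (tT s)).agreeOn (k + 1) X φ ψ →
        (tT s).E (k + 1) X z g φ = (tT s).E (k + 1) X z g ψ)
    (hinvE : ∀ s : SeqOfRecord F θ.ν θ.τ9.M (gOfRecord₁₃ F N θ.toStage13Params p) p.K (k + 1), s.Ω (k + 1) = ∅ → ∀ X z g u φ,
      (tT s).E (k + 1) X z g ((sect2TowerOfRecord F N (FluctV N) p.K (settingOfRecord₁₃ F N θ.toStage13Params p) (θ.rzAt p s) s (tT s)).act u φ) = (tT s).E (k + 1) X z g φ)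
    (hbdE : ∀ s : SeqOfRecord F θ.ν θ.τ9.M (gOfRecord₁₃ F N θ.toStage13Params p) p.K (k + 1), s.Ω (k + 1) = ∅ → ∀ X z g φ, 0 ≤ g →
      g ≤ (settingOfRecord₁₃ F N θ.toStage13Params p).lf.γ →
      φ ∈ (sect2TowerOfRecord F N (FluctV N) p.K (settingOfRecord₁₃ F N θ.toStage13Params p) (θ.rzAt p s) s (tT s)).space (k + 1) X
        ((settingOfRecord₁₃ F N θ.toStage13Params p).lf.alpha0 ((settingOfRecord₁₃ F N θ.toStage13Params p).flow.g (k + 1)))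
        ((settingOfRecord₁₃ F N θ.toStage13Params p).lf.alpha1 ((settingOfRecord₁₃ F N θ.toStage13Params p).flow.g (k + 1))) →
      ‖(tT s).E (k + 1) X z g φ‖ ≤ (settingOfRecord₁₃ F N θ.toStage13Params p).lf.E₀ *
        Real.exp (-((1 + 4 * (settingOfRecord₁₃ F N θ.toStage13Params p).βc) * (settingOfRecord₁₃ F N θ.toStage13Params p).lf.κ) *
          (Sect2.domSys (F.P p.K) θ.τ9.M (k + 1)).dj X))
    (hanE : ∀ s : SeqOfRecord F θ.ν θ.τ9.M (gOfRecord₁₃ F N θ.toStage13Params p) p.K (k + 1), s.Ω (k + 1) = ∅ → ∀ X z g, 0 ≤ g →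
      g ≤ (settingOfRecord₁₃ F N θ.toStage13Params p).lf.γ →
      AnalyticOnNhd ℂ ((tT s).E (k + 1) X z g)
        ((sect2TowerOfRecord F N (FluctV N) p.K (settingOfRecord₁₃ F N θ.toStage13Params p) (θ.rzAt p s) s (tT s)).space (k + 1) X
          ((settingOfRecord₁₃ F N θ.toStage13Params p).lf.alpha0 ((settingOfRecord₁₃ F N θ.toStage13Params p).flow.g (k + 1)))
          ((settingOfRecord₁₃ F N θ.toStage13Params p).lf.alpha1 ((settingOfRecord₁₃ F N θ.toStage13Params p).flow.g (k + 1)))))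
    (hEk : ∀ s : SeqOfRecord F θ.ν θ.τ9.M (gOfRecord₁₃ F N θ.toStage13Params p) p.K (k + 1), s.Ω (k + 1) = ∅ → EkT s = Ek s.init)
    (hqloc : ∀ s : SeqOfRecord F θ.ν θ.τ9.M (gOfRecord₁₃ F N θ.toStage13Params p) p.K (k + 1), s.Ω (k + 1) = ∅ →
      ∀ j, j < k → ∀ ω ω' : MultiCfg (F.P p.K) (SU N) (FluctV N), (∀ i, i ≤ k → ω i = ω' i) →
        (θ.zhAt p s).quad j (s.init.Λ (j + 1)) ω = (θ.zhAt p s).quad j (s.init.Λ (j + 1)) ω')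
    (hpre : ∀ s : SeqOfRecord F θ.ν θ.τ9.M (gOfRecord₁₃ F N θ.toStage13Params p) p.K (k + 1), s.Ω (k + 1) = ∅ →
      ∀ j, j < k → (θ.zhAt p s).ζ0 j = (θ.zhAt p s.init).ζ0 j ∧ (θ.zhAt p s).quad j = (θ.zhAt p s.init).quad j)
    (hA : ∀ s : SeqOfRecord F θ.ν θ.τ9.M (gOfRecord₁₃ F N θ.toStage13Params p) p.K (k + 1), s.Ω (k + 1) = ∅ →
      ∀ (S : ℕ → Set (Site (F.P p.K) 0)) (a a' : Tk.MSFluct (F.P p.K) (FluctV N)) (Uf : GaugeField (F.P p.K) 0 (SU N)), (∀ i, i ≤ k → a i = a' i) →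
      (sect2ActionDataOfRecord F N (FluctV N) p.K (settingOfRecord₁₃ F N θ.toStage13Params p) (θ.rzAt p s.init) s.init (t s.init) (S, a) (Ek s.init)).action23 k Uf =
        (sect2ActionDataOfRecord F N (FluctV N) p.K (settingOfRecord₁₃ F N θ.toStage13Params p) (θ.rzAt p s.init) s.init (t s.init) (S, a') (Ek s.init)).action23 k Uf)
    (hZ : ∀ s : SeqOfRecord F θ.ν θ.τ9.M (gOfRecord₁₃ F N θ.toStage13Params p) p.K (k + 1), s.Ω (k + 1) = ∅ →
      ∀ (V' : GaugeField (F.P p.K) (k + 1) (SU N)) (U₀ : GaugeField (F.P p.K) k (SU N)),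
      (θ.zhAt p s).ζ0 k Set.univ (pairCfgAt (V := FluctV N) k V' U₀) =
        chiSeqOfRecord F N θ.ν θ.τ9.M (gOfRecord₁₃ F N θ.toStage13Params p) p.K k s.init U₀ *
          wOfRecord₉ F N θ.toStage9Params p (gOfRecord₁₃ F N θ.toStage13Params p) k s U₀ ((avOfRecord F N p.K k).avg U₀))
    (hq : ∀ s : SeqOfRecord F θ.ν θ.τ9.M (gOfRecord₁₃ F N θ.toStage13Params p) p.K (k + 1), s.Ω (k + 1) = ∅ →
      ∀ (V' : GaugeField (F.P p.K) (k + 1) (SU N)) (U₀ : GaugeField (F.P p.K) k (SU N)), (θ.zhAt p s).quad k ∅ (pairCfgAt (V := FluctV N) k V' U₀) = 0)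
    (C : ℝ)
    (hmB : ∀ s : SeqOfRecord F θ.ν θ.τ9.M (gOfRecord₁₃ F N θ.toStage13Params p) p.K (k + 1), s.Ω (k + 1) = ∅ →
      ∀ S ∈ admSOfRecord F θ.ν θ.τ9.M (gOfRecord₁₃ F N θ.toStage13Params p) p.K k s.init,
      Measurable fun U₀ : GaugeField (F.P p.K) k (SU N) =>
        tkBranchOfRecord F N (FluctV N) θ.ν θ.τ9.M _ p.K (WtOfRecord₁₃H F N θ p s) s.init S k
          (fun ω => sect2Operand F N (FluctV N) p.K (settingOfRecord₁₃ F N θ.toStage13Params p) (θ.rzAt p s.init) s.init (t s.init) (Ek s.init)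
            (UbgOfRecord₁₃CoP F N θ.toStage13Params p k s.init) (S, fun j => (ω j).2) (fun j => (ω j).1))
          (baseCfg (V := FluctV N) k U₀))
    (hCB : ∀ s : SeqOfRecord F θ.ν θ.τ9.M (gOfRecord₁₃ F N θ.toStage13Params p) p.K (k + 1), s.Ω (k + 1) = ∅ →
      ∀ S ∈ admSOfRecord F θ.ν θ.τ9.M (gOfRecord₁₃ F N θ.toStage13Params p) p.K k s.init, ∀ U₀ : GaugeField (F.P p.K) k (SU N),
      |tkBranchOfRecord F N (FluctV N) θ.ν θ.τ9.M _ p.K (WtOfRecord₁₃H F N θ p s) s.init S k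
          (fun ω => sect2Operand F N (FluctV N) p.K (settingOfRecord₁₃ F N θ.toStage13Params p) (θ.rzAt p s.init) s.init (t s.init) (Ek s.init)
            (UbgOfRecord₁₃CoP F N θ.toStage13Params p k s.init) (S, fun j => (ω j).2) (fun j => (ω j).1))
          (baseCfg (V := FluctV N) k U₀)| ≤ C)
    (hexp : ∀ s : SeqOfRecord F θ.ν θ.τ9.M (gOfRecord₁₃ F N θ.toStage13Params p) p.K (k + 1), s.Ω (k + 1) ≠ ∅ →
      Sect2.LawsT (sect2TowerOfRecord F N (FluctV N) p.K (settingOfRecord₁₃ F N θ.toStage13Params p) (θ.rzAt p s) s (tT s))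
          (settingOfRecord₁₃ F N θ.toStage13Params p).lf (settingOfRecord₁₃ F N θ.toStage13Params p).βc k ∧
        (slotsTOfRecord F N θ.ν θ.τ9 (EOfRecord₁₃ F N θ.toStage13Params) (wOfRecord₉ F N θ.toStage9Params) θ.ppSel p
            (gOfRecord₁₃ F N θ.toStage13Params p) (k + 1) s = 0 ∨
          ∀ᵐ V' ∂fieldMeasure (F.P p.K) (k + 1) (SU N),
            chiSeqOfRecord F N θ.ν θ.τ9.M (gOfRecord₁₃ F N θ.toStage13Params p) p.K (k + 1) s V' ≠ 0 →
              slotsTOfRecord F N θ.ν θ.τ9 (EOfRecord₁₃ F N θ.toStage13Params) (wOfRecord₉ F N θ.toStage9Params) θ.ppSel p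
                  (gOfRecord₁₃ F N θ.toStage13Params p) (k + 1) s V' =
                sect2Slot F N (FluctV N) p.K (settingOfRecord₁₃ F N θ.toStage13Params p) (θ.rzAt p s) (WtOfRecord₁₃H F N θ p s) s (tT s) (EkT s)
                  (UbgOfRecord₁₃CoP F N θ.toStage13Params p (k + 1) s) V')) :
    TLaw₁₃CoPH F N θ p k := by
  obtain ⟨-, hs⟩ := hS
  refine (tLaw₁₃CoPH_iff F N θ p k).mpr ⟨tT, EkT, huT, fun s => ?_⟩
  by_cases hΩ : s.Ω (k + 1) = ∅
  · -- NO-EXPANSION new sequence: §0 for the laws, dag-n11-d's old-branch step read at `tT s` for the clause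
    obtain ⟨hE, hR, hB⟩ := hold s hΩ
    have htw := sect2TowerOfRecord_rzAt_succ_eq_init_of_Omega_empty θ p s hΩ (t s.init)
    have hlaw : Sect2.LawsRT (sect2TowerOfRecord F N (FluctV N) p.K (settingOfRecord₁₃ F N θ.toStage13Params p) (θ.rzAt p s) s (t s.init))
        (settingOfRecord₁₃ F N θ.toStage13Params p).lf k := by
      rw [htw]; exact (hs s.init).1
    refine ⟨lawsT_towerOfTerms_of_lawsRT_of_agree_of_newE _ _ _ hE hR hB (hnoR s hΩ) (hnoB s hΩ) (hlocE s hΩ) (hinvE s hΩ) (hbdE s hΩ) (hanE s hΩ)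
      hlaw (settingOfRecord₁₃_satisfiesRG F N θ.toStage13Params p (k + 1) k (Nat.lt_succ_self k)) hB₀
      (B16RLeafRecord13Live.gOfRecord₁₃_succ_nonneg F N θ.toStage13Params p k), ?_⟩
    rw [hEk s hΩ, sect2Slot_succ_congr_of_agree_of_Omega_empty (FluctV N) _ _ _ hM s hΩ hE hR hB]
    exact clause_succ_CoPH_of_Omega_empty_of_pinChi_of_oldBranch_of_clause θ p h hk hM s hΩ (hqloc s hΩ) (hpre s hΩ) (t s.init) (Ek s.init)
      (hA s hΩ) (hs s.init).2 (hZ s hΩ) (hq s hΩ) (hmB s hΩ) (hCB s hΩ)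
  · -- EXPANSION new sequence: [III] §3 proper, displayed
    exact hexp s hΩ

/-- **★★★ … HENCE `SLaw₁₃CoPH θ p (k+1)` ON THE LIVE-SELECTOR LINE** — Theorem 1's complete inductive step `ρ_k ↦ ρ_{k+1}` at the v1.7 record from the same inputs plus
node00-def-T's selector clause, admissibility and the signs `0 ≤ κ, E₀` (this seat's `…LiveCoPH.sLaw₁₃CoPH_succ_of_tLaw₁₃CoPH_of_liveSel_of_rstep`: 𝐑 of record moves only dead
sequences).  MODULO EXACTLY: `hexp` (the expansion sequences), the new universal 𝐄-terms' clauses, and dag-n11-d's displayed no-expansion binders.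
[cite: Balaban1988Convergent, Thm 1 p.262, Theorem p.245, §2 p.262, (3.24)–(3.25) p.270, (2.17)–(2.18) p.257, p.279; Balaban1989LargeFieldI, (0.2)–(0.4) p.176, p.177 (i)–(ii)] -/
theorem sLaw₁₃CoPH_succ_of_formAtZS_of_newTerms_of_expansion_of_liveSel (h : θ.Provisos₁₃CoPH F N)
    (hsel : θ.ppSel = ppSelLiveOfRecord F N θ.ν θ.τ9 (EOfRecord₁₃ F N θ.toStage13Params) (wOfRecord₉ F N θ.toStage9Params))
    (hθ : θ.Admissible F N) (hκ : 0 ≤ θ.s2.lf.κ) (hE₀ : 0 ≤ θ.s2.lf.E₀) (hB₀ : 0 ≤ θ.s2.lf.B₀) {k : ℕ} (hk : k < p.K) (hM : 1 ≤ θ.τ9.M)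
    (t : SeqOfRecord F θ.ν θ.τ9.M (gOfRecord₁₃ F N θ.toStage13Params p) p.K k → Sect2.TermValues (F.P p.K) (MatA N) (FluctV N) θ.τ9.M)
    (Ek : SeqOfRecord F θ.ν θ.τ9.M (gOfRecord₁₃ F N θ.toStage13Params p) p.K k → ℝ)
    (hS : HasSect2FormAtZS F N (FluctV N) p.K (settingOfRecord₁₃ F N θ.toStage13Params p) k (θ.rzAt p) (WtOfRecord₁₃H F N θ p)
      (UbgOfRecord₁₃CoP F N θ.toStage13Params p k)
      (fun s u => Sect2.LawsRT (sect2TowerOfRecord F N (FluctV N) p.K (settingOfRecord₁₃ F N θ.toStage13Params p) (θ.rzAt p s) s u)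
        (settingOfRecord₁₃ F N θ.toStage13Params p).lf k)
      (slotsOfRecord F N θ.ν θ.τ9 (EOfRecord₁₃ F N θ.toStage13Params) (wOfRecord₉ F N θ.toStage9Params) θ.ppSel p (gOfRecord₁₃ F N θ.toStage13Params p) k) t Ek)
    (tT : SeqOfRecord F θ.ν θ.τ9.M (gOfRecord₁₃ F N θ.toStage13Params p) p.K (k + 1) → Sect2.TermValues (F.P p.K) (MatA N) (FluctV N) θ.τ9.M)
    (EkT : SeqOfRecord F θ.ν θ.τ9.M (gOfRecord₁₃ F N θ.toStage13Params p) p.K (k + 1) → ℝ) (huT : Sect2.UniversalE tT)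
    (hold : ∀ s : SeqOfRecord F θ.ν θ.τ9.M (gOfRecord₁₃ F N θ.toStage13Params p) p.K (k + 1), s.Ω (k + 1) = ∅ →
      (∀ j, j ≤ k → ∀ X z g φ, (tT s).E j X z g φ = (t s.init).E j X z g φ) ∧ (∀ j, j ≤ k → ∀ X φ, (tT s).R j X φ = (t s.init).R j X φ) ∧
        (∀ j, j ≤ k → ∀ X φ a, (tT s).B j X φ a = (t s.init).B j X φ a))
    (hnoR : ∀ s : SeqOfRecord F θ.ν θ.τ9.M (gOfRecord₁₃ F N θ.toStage13Params p) p.K (k + 1), s.Ω (k + 1) = ∅ → ∀ X φ, (tT s).R (k + 1) X φ = 0)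
    (hnoB : ∀ s : SeqOfRecord F θ.ν θ.τ9.M (gOfRecord₁₃ F N θ.toStage13Params p) p.K (k + 1), s.Ω (k + 1) = ∅ → ∀ X φ a, (tT s).B (k + 1) X φ a = 0)
    (hlocE : ∀ s : SeqOfRecord F θ.ν θ.τ9.M (gOfRecord₁₃ F N θ.toStage13Params p) p.K (k + 1), s.Ω (k + 1) = ∅ → ∀ X z g φ ψ,
      (sect2TowerOfRecord F N (FluctV N) p.K (settingOfRecord₁₃ F N θ.toStage13Params p) (θ.rzAt p s) s (tT s)).agreeOn (k + 1) X φ ψ →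
        (tT s).E (k + 1) X z g φ = (tT s).E (k + 1) X z g ψ)
    (hinvE : ∀ s : SeqOfRecord F θ.ν θ.τ9.M (gOfRecord₁₃ F N θ.toStage13Params p) p.K (k + 1), s.Ω (k + 1) = ∅ → ∀ X z g u φ,
      (tT s).E (k + 1) X z g ((sect2TowerOfRecord F N (FluctV N) p.K (settingOfRecord₁₃ F N θ.toStage13Params p) (θ.rzAt p s) s (tT s)).act u φ) = (tT s).E (k + 1) X z g φ)
    (hbdE : ∀ s : SeqOfRecord F θ.ν θ.τ9.M (gOfRecord₁₃ F N θ.toStage13Params p) p.K (k + 1), s.Ω (k + 1) = ∅ → ∀ X z g φ, 0 ≤ g →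
      g ≤ (settingOfRecord₁₃ F N θ.toStage13Params p).lf.γ →
      φ ∈ (sect2TowerOfRecord F N (FluctV N) p.K (settingOfRecord₁₃ F N θ.toStage13Params p) (θ.rzAt p s) s (tT s)).space (k + 1) X
        ((settingOfRecord₁₃ F N θ.toStage13Params p).lf.alpha0 ((settingOfRecord₁₃ F N θ.toStage13Params p).flow.g (k + 1)))
        ((settingOfRecord₁₃ F N θ.toStage13Params p).lf.alpha1 ((settingOfRecord₁₃ F N θ.toStage13Params p).flow.g (k + 1))) →
      ‖(tT s).E (k + 1) X z g φ‖ ≤ (settingOfRecord₁₃ F N θ.toStage13Params p).lf.E₀ *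
        Real.exp (-((1 + 4 * (settingOfRecord₁₃ F N θ.toStage13Params p).βc) * (settingOfRecord₁₃ F N θ.toStage13Params p).lf.κ) *
          (Sect2.domSys (F.P p.K) θ.τ9.M (k + 1)).dj X))
    (hanE : ∀ s : SeqOfRecord F θ.ν θ.τ9.M (gOfRecord₁₃ F N θ.toStage13Params p) p.K (k + 1), s.Ω (k + 1) = ∅ → ∀ X z g, 0 ≤ g →
      g ≤ (settingOfRecord₁₃ F N θ.toStage13Params p).lf.γ →
      AnalyticOnNhd ℂ ((tT s).E (k + 1) X z g)
        ((sect2TowerOfRecord F N (FluctV N) p.K (settingOfRecord₁₃ F N θ.toStage13Params p) (θ.rzAt p s) s (tT s)).space (k + 1) X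
          ((settingOfRecord₁₃ F N θ.toStage13Params p).lf.alpha0 ((settingOfRecord₁₃ F N θ.toStage13Params p).flow.g (k + 1)))
          ((settingOfRecord₁₃ F N θ.toStage13Params p).lf.alpha1 ((settingOfRecord₁₃ F N θ.toStage13Params p).flow.g (k + 1)))))
    (hEk : ∀ s : SeqOfRecord F θ.ν θ.τ9.M (gOfRecord₁₃ F N θ.toStage13Params p) p.K (k + 1), s.Ω (k + 1) = ∅ → EkT s = Ek s.init)
    (hqloc : ∀ s : SeqOfRecord F θ.ν θ.τ9.M (gOfRecord₁₃ F N θ.toStage13Params p) p.K (k + 1), s.Ω (k + 1) = ∅ →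
      ∀ j, j < k → ∀ ω ω' : MultiCfg (F.P p.K) (SU N) (FluctV N), (∀ i, i ≤ k → ω i = ω' i) →
        (θ.zhAt p s).quad j (s.init.Λ (j + 1)) ω = (θ.zhAt p s).quad j (s.init.Λ (j + 1)) ω')
    (hpre : ∀ s : SeqOfRecord F θ.ν θ.τ9.M (gOfRecord₁₃ F N θ.toStage13Params p) p.K (k + 1), s.Ω (k + 1) = ∅ →
      ∀ j, j < k → (θ.zhAt p s).ζ0 j = (θ.zhAt p s.init).ζ0 j ∧ (θ.zhAt p s).quad j = (θ.zhAt p s.init).quad j)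
    (hA : ∀ s : SeqOfRecord F θ.ν θ.τ9.M (gOfRecord₁₃ F N θ.toStage13Params p) p.K (k + 1), s.Ω (k + 1) = ∅ →
      ∀ (S : ℕ → Set (Site (F.P p.K) 0)) (a a' : Tk.MSFluct (F.P p.K) (FluctV N)) (Uf : GaugeField (F.P p.K) 0 (SU N)), (∀ i, i ≤ k → a i = a' i) →
      (sect2ActionDataOfRecord F N (FluctV N) p.K (settingOfRecord₁₃ F N θ.toStage13Params p) (θ.rzAt p s.init) s.init (t s.init) (S, a) (Ek s.init)).action23 k Uf =
        (sect2ActionDataOfRecord F N (FluctV N) p.K (settingOfRecord₁₃ F N θ.toStage13Params p) (θ.rzAt p s.init) s.init (t s.init) (S, a') (Ek s.init)).action23 k Uf)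
    (hZ : ∀ s : SeqOfRecord F θ.ν θ.τ9.M (gOfRecord₁₃ F N θ.toStage13Params p) p.K (k + 1), s.Ω (k + 1) = ∅ →
      ∀ (V' : GaugeField (F.P p.K) (k + 1) (SU N)) (U₀ : GaugeField (F.P p.K) k (SU N)),
      (θ.zhAt p s).ζ0 k Set.univ (pairCfgAt (V := FluctV N) k V' U₀) =
        chiSeqOfRecord F N θ.ν θ.τ9.M (gOfRecord₁₃ F N θ.toStage13Params p) p.K k s.init U₀ *
          wOfRecord₉ F N θ.toStage9Params p (gOfRecord₁₃ F N θ.toStage13Params p) k s U₀ ((avOfRecord F N p.K k).avg U₀))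
    (hq : ∀ s : SeqOfRecord F θ.ν θ.τ9.M (gOfRecord₁₃ F N θ.toStage13Params p) p.K (k + 1), s.Ω (k + 1) = ∅ →
      ∀ (V' : GaugeField (F.P p.K) (k + 1) (SU N)) (U₀ : GaugeField (F.P p.K) k (SU N)), (θ.zhAt p s).quad k ∅ (pairCfgAt (V := FluctV N) k V' U₀) = 0)
    (C : ℝ)
    (hmB : ∀ s : SeqOfRecord F θ.ν θ.τ9.M (gOfRecord₁₃ F N θ.toStage13Params p) p.K (k + 1), s.Ω (k + 1) = ∅ →
      ∀ S ∈ admSOfRecord F θ.ν θ.τ9.M (gOfRecord₁₃ F N θ.toStage13Params p) p.K k s.init,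
      Measurable fun U₀ : GaugeField (F.P p.K) k (SU N) =>
        tkBranchOfRecord F N (FluctV N) θ.ν θ.τ9.M _ p.K (WtOfRecord₁₃H F N θ p s) s.init S k
          (fun ω => sect2Operand F N (FluctV N) p.K (settingOfRecord₁₃ F N θ.toStage13Params p) (θ.rzAt p s.init) s.init (t s.init) (Ek s.init)
            (UbgOfRecord₁₃CoP F N θ.toStage13Params p k s.init) (S, fun j => (ω j).2) (fun j => (ω j).1))
          (baseCfg (V := FluctV N) k U₀))
    (hCB : ∀ s : SeqOfRecord F θ.ν θ.τ9.M (gOfRecord₁₃ F N θ.toStage13Params p) p.K (k + 1), s.Ω (k + 1) = ∅ →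
      ∀ S ∈ admSOfRecord F θ.ν θ.τ9.M (gOfRecord₁₃ F N θ.toStage13Params p) p.K k s.init, ∀ U₀ : GaugeField (F.P p.K) k (SU N),
      |tkBranchOfRecord F N (FluctV N) θ.ν θ.τ9.M _ p.K (WtOfRecord₁₃H F N θ p s) s.init S k
          (fun ω => sect2Operand F N (FluctV N) p.K (settingOfRecord₁₃ F N θ.toStage13Params p) (θ.rzAt p s.init) s.init (t s.init) (Ek s.init)
            (UbgOfRecord₁₃CoP F N θ.toStage13Params p k s.init) (S, fun j => (ω j).2) (fun j => (ω j).1))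
          (baseCfg (V := FluctV N) k U₀)| ≤ C)
    (hexp : ∀ s : SeqOfRecord F θ.ν θ.τ9.M (gOfRecord₁₃ F N θ.toStage13Params p) p.K (k + 1), s.Ω (k + 1) ≠ ∅ →
      Sect2.LawsT (sect2TowerOfRecord F N (FluctV N) p.K (settingOfRecord₁₃ F N θ.toStage13Params p) (θ.rzAt p s) s (tT s))
          (settingOfRecord₁₃ F N θ.toStage13Params p).lf (settingOfRecord₁₃ F N θ.toStage13Params p).βc k ∧
        (slotsTOfRecord F N θ.ν θ.τ9 (EOfRecord₁₃ F N θ.toStage13Params) (wOfRecord₉ F N θ.toStage9Params) θ.ppSel p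
            (gOfRecord₁₃ F N θ.toStage13Params p) (k + 1) s = 0 ∨
          ∀ᵐ V' ∂fieldMeasure (F.P p.K) (k + 1) (SU N),
            chiSeqOfRecord F N θ.ν θ.τ9.M (gOfRecord₁₃ F N θ.toStage13Params p) p.K (k + 1) s V' ≠ 0 →
              slotsTOfRecord F N θ.ν θ.τ9 (EOfRecord₁₃ F N θ.toStage13Params) (wOfRecord₉ F N θ.toStage9Params) θ.ppSel p
                  (gOfRecord₁₃ F N θ.toStage13Params p) (k + 1) s V' =
                sect2Slot F N (FluctV N) p.K (settingOfRecord₁₃ F N θ.toStage13Params p) (θ.rzAt p s) (WtOfRecord₁₃H F N θ p s) s (tT s) (EkT s)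
                  (UbgOfRecord₁₃CoP F N θ.toStage13Params p (k + 1) s) V')) :
    SLaw₁₃CoPH F N θ p (k + 1) :=
  sLaw₁₃CoPH_succ_of_tLaw₁₃CoPH_of_liveSel_of_rstep F N θ p (fun q j _ hj => h.rstep q j hj) hθ hκ hE₀ hB₀ hsel k hk
    (tLaw₁₃CoPH_of_formAtZS_of_newTerms_of_expansion θ p h hk hM hB₀ t Ek hS tT EkT huT hold hnoR hnoB hlocE hinvE hbdE hanE hEk hqloc hpre hA hZ hq C hmB hCB hexp)

end Reduction

end Summit.QuantumFields.YangMills.Theorems.BalabanUVNodesN11NoExpansionStepReductionCoPH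

end
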